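import Literature.Analysis.PDE.QuasilinearPicard
import HarnessLib

/-!
# The frozen Picard scheme for quasilinear parabolic systems: the iterates (topic `Analysis/PDE`)

Layer (III), step 5c (the iteration), of the programme to prove short-time existence for
quasilinear strictly parabolic systems on a closed manifold (hypothesis `hQL` of
`Literature.Geometry.Riemannian.ricciFlow_shortTime_existence_of_quasilinear`). Given the data `D`
of the frozen scheme (`QuasilinearPicard.lean`), linear existence in the `linOp` form on every
sub-slab of `[0, 1]`, and the weighted maximal-regularity a priori estimate with a source constant
independent of the order, this file constructs the Picard iterates
`∂ₜ v_{k+1} = L v_{k+1} + Θ(v_k)`, `v_{k+1}(0) = 0`, `v_0 = 0` on a short interval `[0, T]` and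
proves the base-level invariant: chart-slab smoothness, small energies of all cut-off chart
expressions at all times (hence admissible graphs and small jets), and boundedness of the weighted
maximal-regularity quantity.

* `PicardData.exists_iterates`.

Everything is proved; no named fact and no `sorry` is introduced.

## References

* M. E. Taylor, *Partial Differential Equations III*, 2nd ed., Springer 2011, Ch. 15, §7.
  [TaylorPDEIII2011]
-/

noncomputable section

open Set Function Filter Topology Metric MeasureTheory InnerProductSpace
open scoped Manifold ContDiff Topology ENNReal RealInnerProductSpace

namespace Literature.Analysis.PDE

open Literature.Geometry.Manifold Literature.Analysis.FunctionSpaces Literature.Analysis.FluidPDE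

variable {E : Type*} [NormedAddCommGroup E] [NormedSpace ℝ E] {H : Type*} [TopologicalSpace H]
variable {I : ModelWithCorners ℝ E H} {M : Type*} [TopologicalSpace M] [ChartedSpace H M]
variable {E' : Type*} [NormedAddCommGroup E'] [InnerProductSpace ℝ E'] [FiniteDimensional ℝ E']
  [MeasurableSpace E'] [BorelSpace E']
variable {W' : Type*} [NormedAddCommGroup W'] [InnerProductSpace ℝ W'] [FiniteDimensional ℝ W']
variable {ιb : Type*} [Fintype ιb] {ι : Type*} [Fintype ι]

/-! ### Small tools -/

omit [FiniteDimensional ℝ E'] [MeasurableSpace E'] [BorelSpace E'] [FiniteDimensional ℝ W'] in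
/-- A function whose chart expressions are smooth is smooth on `M`. [cite: Lee2013, Thm. 2.23] -/
theorem PatchSystemLoc.contMDiff_of_chartSmooth [I.Boundaryless] [IsManifold I ∞ M] (PS : PatchSystem I M E' ι) {u : M → W'}
    (hu : ∀ q, ContDiffOn ℝ ∞ (u ∘ (PS.chart q).inv) (PS.chart q).target) : ContMDiff I 𝓘(ℝ, W') ∞ u := by
  intro x
  obtain ⟨p, hxp, -⟩ := PS.cover x
  exact (PS.chart p).contMDiffAt_of_contDiffOn_comp_inv (hu p) hxp

omit [FiniteDimensional ℝ E'] [MeasurableSpace E'] [BorelSpace E'] [FiniteDimensional ℝ W'] in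
/-- The slice of a chart-slab-smooth family has smooth chart expressions. [folklore] -/
theorem PatchSystemLoc.chartSmooth_slice (PS : PatchSystem I M E' ι) {T : ℝ} {v : ℝ → M → W'}
    (hv : ∀ q, ContDiffOn ℝ ∞ (uncurry fun s y ↦ v s ((PS.chart q).inv y)) (Icc 0 T ×ˢ (PS.chart q).target)) {s : ℝ} (hs : s ∈ Icc 0 T) (q : ι) :
    ContDiffOn ℝ ∞ (v s ∘ (PS.chart q).inv) (PS.chart q).target :=
  (hv q).comp (contDiff_const.prodMk contDiff_id).contDiffOn fun _ hy ↦ mk_mem_prod hs hy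

omit [FiniteDimensional ℝ W'] in
/-- `maxRegQ` is monotone in the time. [folklore] -/
theorem PatchSystemLoc.maxRegQ_mono_time (k : ℕ) (lam : ℝ) (w : ℝ → E' → W') {t t' : ℝ} (h : t ≤ t') :
    PatchSystemLoc.maxRegQ k lam w t ≤ PatchSystemLoc.maxRegQ k lam w t' := by
  rw [PatchSystemLoc.maxRegQ_eq, PatchSystemLoc.maxRegQ_eq]
  exact lintegral_mono_set (Ioo_subset_Ioo le_rfl h)

omit [MeasurableSpace E'] [BorelSpace E'] [FiniteDimensional ℝ W'] in
/-- The cut-off expression of the zero function vanishes. [folklore] -/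
theorem PatchSystemLoc.cutExpr_zero_fun (PS : PatchSystem I M E' ι) (q : ι) :
    PatchSystemLoc.cutExpr PS q (fun _ : M ↦ (0 : W')) = fun _ ↦ 0 := by
  funext y; simp [PatchSystemLoc.cutExpr]

omit [FiniteDimensional ℝ W'] in
/-- `maxRegQ` of the zero family vanishes. [folklore] -/
theorem PatchSystemLoc.maxRegQ_zero_fun (k : ℕ) (lam t : ℝ) :
    PatchSystemLoc.maxRegQ k lam (fun (_ : ℝ) (_ : E') ↦ (0 : W')) t = 0 := by
  rw [PatchSystemLoc.maxRegQ_eq]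
  have h1 : ∀ v : E', (fun x : E' ↦ fderiv ℝ (fun _ : E' ↦ (0 : W')) x v) = fun _ ↦ 0 := by intro v; funext x; simp
  simp only [h1, sobolevEnergy_zero_fun, Finset.sum_const_zero, mul_zero, add_zero, lintegral_const, zero_mul]

/-! ### The time-integrated source energy of differences -/

section Diff

variable [I.Boundaryless] [HasContDiffBump E'] [CompactSpace M] [T2Space M] [IsManifold I ∞ M]
variable (D : PicardData I M E' W' ιb ι)

/-- **The time-integrated source energy of differences.** For every order `K` and every `R` there
is `B < ∞` such that for chart-slab-smooth `v, v'` on `[0, T]` whose slices satisfy the hypotheses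
of `sum_energy_theta_sub_le`, every `λ ≥ 1` and `t ∈ [0, T]`:
`Σ_p ∫₀ᵗ e^{-2λs} E_K(cutExpr_p (Θ(v s) - Θ(v' s))) ≤ |ι| c_top δ² 𝒬 + B λ⁻¹ 𝒬`,
`𝒬 = Σ_q maxRegQ K λ (ŵ_q(v) - ŵ_q(v')) t`. [cite: TaylorPDEIII2011, Ch. 15, §7] -/
theorem PicardData.sum_lintegral_energy_theta_sub_le (K : ℕ) (R : ℝ) :
    ∃ B : ℝ≥0∞, B ≠ ⊤ ∧ ∀ {T : ℝ}, 0 < T → ∀ {v v' : ℝ → M → W'},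
      (∀ q, ContDiffOn ℝ ∞ (uncurry fun s y ↦ v s ((D.PS.chart q).inv y)) (Icc 0 T ×ˢ (D.PS.chart q).target)) →
      (∀ q, ContDiffOn ℝ ∞ (uncurry fun s y ↦ v' s ((D.PS.chart q).inv y)) (Icc 0 T ×ˢ (D.PS.chart q).target)) →
      (∀ s ∈ Icc 0 T, ContMDiff I 𝓘(ℝ, W') ∞ (v s)) → (∀ s ∈ Icc 0 T, ContMDiff I 𝓘(ℝ, W') ∞ (v' s)) →
      (∀ s ∈ Icc 0 T, ∀ x, (x, D.u₀ x + v s x) ∈ D.𝒪) → (∀ s ∈ Icc 0 T, ∀ x, (x, D.u₀ x + v' s x) ∈ D.𝒪) →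
      (∀ s ∈ Icc 0 T, ∀ p y, D.PS.cut p y ≠ 0 → jetQ (jetOf (v s ∘ (D.PS.chart p).inv) y) ≤ D.ρ' ^ 2) →
      (∀ s ∈ Icc 0 T, ∀ p y, D.PS.cut p y ≠ 0 → jetQ (jetOf (v' s ∘ (D.PS.chart p).inv) y) ≤ D.ρ' ^ 2) →
      (∀ s ∈ Icc 0 T, ∀ p, ∀ m ≤ K + 2, ∀ y, ‖iteratedFDeriv ℝ m (PatchSystemLoc.zExpr D.PS p (v s)) y‖ ≤ R) →
      (∀ s ∈ Icc 0 T, ∀ p, ∀ m ≤ K + 2, ∀ y, ‖iteratedFDeriv ℝ m (PatchSystemLoc.zExpr D.PS p (v' s)) y‖ ≤ R) →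
      ∀ {δ : ℝ}, 0 ≤ δ → δ ≤ 1 → (∀ s ∈ Icc 0 T, ∀ p i i' y, |D.Gc p i i' (y, jetOf (PatchSystemLoc.zExpr D.PS p (v s)) y)| ≤ δ) →
      ∀ {lam : ℝ}, 1 ≤ lam → ∀ t ∈ Icc 0 T,
      ∑ p, (∫⁻ s in Ioo 0 t, ENNReal.ofReal (Real.exp (-2 * lam * s)) * sobolevEnergy K (PatchSystemLoc.cutExpr D.PS p (fun x ↦ D.theta (v s) x - D.theta (v' s) x))) ≤
        (Fintype.card ι : ℝ≥0∞) * ENNReal.ofReal (D.ctop * δ ^ 2) * ∑ q, PatchSystemLoc.maxRegQ K lam (fun s ↦ PatchSystemLoc.cutExpr D.PS q (fun x ↦ v s x - v' s x)) t +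
          B * (ENNReal.ofReal lam⁻¹ * ∑ q, PatchSystemLoc.maxRegQ K lam (fun s ↦ PatchSystemLoc.cutExpr D.PS q (fun x ↦ v s x - v' s x)) t) := by
  classical
  obtain ⟨B, hBtop, hB⟩ := D.sum_energy_theta_sub_le K R
  refine ⟨(Fintype.card ι : ℝ≥0∞) * B, ENNReal.mul_ne_top (ENNReal.natCast_ne_top _) hBtop, ?_⟩
  intro T hT v v' hv hv' hvs hv's hgv hgv' hjet hjet' hR hR' δ hδ0 hδ1 hδ lam hlam t ht
  set Wt : ℝ → ℝ≥0∞ := fun s ↦ ENNReal.ofReal (Real.exp (-2 * lam * s)) with hWt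
  set w : ι → ℝ → E' → W' := fun q s ↦ PatchSystemLoc.cutExpr D.PS q (fun x ↦ v s x - v' s x) with hw
  have hvv' : ∀ q, ContDiffOn ℝ ∞ (uncurry fun s y ↦ (fun s x ↦ v s x - v' s x) s ((D.PS.chart q).inv y)) (Icc 0 T ×ˢ (D.PS.chart q).target) :=
    fun q ↦ (hv q).sub (hv' q)
  have hws : ∀ q, IsSmoothSpaceTimeOn (Icc 0 T) (w q) := fun q ↦ PatchSystemLoc.isSmoothSpaceTimeOn_cutExpr D.PS q (hvv' q)
  set Q := ∑ q, PatchSystemLoc.maxRegQ K lam (w q) t with hQ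
  set cδ : ℝ≥0∞ := ENNReal.ofReal (D.ctop * δ ^ 2) with hcδ
  have hslice : ∀ s ∈ Ioo 0 t, ∀ p, Wt s * sobolevEnergy K (PatchSystemLoc.cutExpr D.PS p (fun x ↦ D.theta (v s) x - D.theta (v' s) x)) ≤
      Wt s * (cδ * ∑ q, hessEnergy K (w q s) + B * ∑ q, sobolevEnergy (K + 1) (w q s)) := by
    intro s hs p
    have hsI : s ∈ Icc 0 T := ⟨hs.1.le, hs.2.le.trans ht.2⟩
    refine mul_le_mul' le_rfl ((Finset.single_le_sum (f := fun p ↦ sobolevEnergy K (PatchSystemLoc.cutExpr D.PS p (fun x ↦ D.theta (v s) x - D.theta (v' s) x)))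
      (fun _ _ ↦ bot_le) (Finset.mem_univ p)).trans ?_)
    exact hB (hvs s hsI) (hv's s hsI) (hgv s hsI) (hgv' s hsI) (hjet s hsI) (hjet' s hsI) (hR s hsI) (hR' s hsI) hδ0 hδ1 (hδ s hsI)
  have hWm : Measurable Wt := ENNReal.measurable_ofReal.comp (Real.measurable_exp.comp (measurable_const.mul measurable_id))
  have hd1 : ∀ q b, IsSmoothSpaceTimeOn (Icc 0 T) fun s y ↦ fderiv ℝ (w q s) y (stdOrthonormalBasis ℝ E' b) := fun q b ↦ isSmoothSpaceTimeOn_fderiv_apply_Icc hT (hws q) _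
  have hd2 : ∀ q a b, IsSmoothSpaceTimeOn (Icc 0 T) fun s y ↦ fderiv ℝ (fun x ↦ fderiv ℝ (w q s) x (stdOrthonormalBasis ℝ E' b)) y (stdOrthonormalBasis ℝ E' a) :=
    fun q a b ↦ isSmoothSpaceTimeOn_fderiv_apply_Icc hT (hd1 q b) _
  have hmH : ∀ q, AEMeasurable (fun s ↦ hessEnergy K (w q s)) (volume.restrict (Ioo 0 t)) := fun q ↦ by
    simp only [hessEnergy_eq]
    exact Finset.aemeasurable_fun_sum _ fun a _ ↦ Finset.aemeasurable_fun_sum _ fun b _ ↦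
      aemeasurable_sobolevEnergy_slice isOpen_Ioo K ((hd2 q a b).mono fun _ hs ↦ ⟨hs.1.le, hs.2.le.trans ht.2⟩)
  have hm2 : AEMeasurable (fun s ↦ Wt s * (cδ * ∑ q, hessEnergy K (w q s))) (volume.restrict (Ioo 0 t)) :=
    hWm.aemeasurable.mul ((Finset.aemeasurable_fun_sum _ fun q _ ↦ hmH q).const_mul _)
  have hI2 : (∫⁻ s in Ioo 0 t, Wt s * (cδ * ∑ q, hessEnergy K (w q s))) ≤ cδ * Q := by
    have heq : (fun s ↦ Wt s * (cδ * ∑ q, hessEnergy K (w q s))) = fun s ↦ cδ * ∑ q, Wt s * hessEnergy K (w q s) := by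
      funext s; rw [Finset.mul_sum, Finset.mul_sum, Finset.mul_sum]; exact Finset.sum_congr rfl fun q _ ↦ by ring
    rw [heq, lintegral_const_mul' _ _ ENNReal.ofReal_ne_top, lintegral_finsetSum' _ fun q _ ↦ ?_]
    · refine mul_le_mul' le_rfl ?_
      rw [hQ]
      exact Finset.sum_le_sum fun q _ ↦ lintegral_weight_hessEnergy_le_maxRegQ K lam (w q) t
    · exact hWm.aemeasurable.mul (hmH q)
  have hI1 : (∫⁻ s in Ioo 0 t, Wt s * (B * ∑ q, sobolevEnergy (K + 1) (w q s))) ≤ B * (ENNReal.ofReal lam⁻¹ * Q) := by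
    have heq : (fun s ↦ Wt s * (B * ∑ q, sobolevEnergy (K + 1) (w q s))) = fun s ↦ B * ∑ q, Wt s * sobolevEnergy (K + 1) (w q s) := by
      funext s; rw [Finset.mul_sum, Finset.mul_sum, Finset.mul_sum]; exact Finset.sum_congr rfl fun q _ ↦ by ring
    rw [heq, lintegral_const_mul' _ _ hBtop, lintegral_finsetSum' _ fun q _ ↦ ?_]
    · refine mul_le_mul' le_rfl ?_
      rw [hQ, Finset.mul_sum]
      exact Finset.sum_le_sum fun q _ ↦ (lintegral_weight_sobolevEnergy_le_maxRegQ K hlam (w q) t).2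
    · exact hWm.aemeasurable.mul (aemeasurable_sobolevEnergy_slice isOpen_Ioo (K + 1) ((hws q).mono fun _ hs ↦ ⟨hs.1.le, hs.2.le.trans ht.2⟩))
  calc ∑ p, (∫⁻ s in Ioo 0 t, Wt s * sobolevEnergy K (PatchSystemLoc.cutExpr D.PS p (fun x ↦ D.theta (v s) x - D.theta (v' s) x)))
      ≤ ∑ _p : ι, ∫⁻ s in Ioo 0 t, Wt s * (cδ * ∑ q, hessEnergy K (w q s) + B * ∑ q, sobolevEnergy (K + 1) (w q s)) :=
        Finset.sum_le_sum fun p _ ↦ setLIntegral_mono' measurableSet_Ioo fun s hs ↦ hslice s hs p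
    _ = (Fintype.card ι : ℝ≥0∞) * ((∫⁻ s in Ioo 0 t, Wt s * (cδ * ∑ q, hessEnergy K (w q s))) + ∫⁻ s in Ioo 0 t, Wt s * (B * ∑ q, sobolevEnergy (K + 1) (w q s))) := by
        rw [Finset.sum_const, Finset.card_univ, nsmul_eq_mul]
        congr 1
        have hfun : (fun s ↦ Wt s * (cδ * ∑ q, hessEnergy K (w q s) + B * ∑ q, sobolevEnergy (K + 1) (w q s))) =
            fun s ↦ Wt s * (cδ * ∑ q, hessEnergy K (w q s)) + Wt s * (B * ∑ q, sobolevEnergy (K + 1) (w q s)) := by funext s; ring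
        rw [hfun, lintegral_add_left' hm2]
    _ ≤ (Fintype.card ι : ℝ≥0∞) * (cδ * Q + B * (ENNReal.ofReal lam⁻¹ * Q)) := mul_le_mul' le_rfl (add_le_add hI2 hI1)
    _ = _ := by ring

end Diff

/-! ### The iterates and the base-level invariant -/

section Iterates

variable [I.Boundaryless] [HasContDiffBump E'] [CompactSpace M] [T2Space M] [IsManifold I ∞ M]
variable (D : PicardData I M E' W' ιb ι)

set_option maxHeartbeats 3200000 in
/-- **The Picard iterates.** Assume linear existence in the `linOp` form on every sub-slab of
`[0, 1]` and the weighted maximal-regularity a priori estimate with a source constant `C_lin < ∞`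
serving every order and every sub-slab. Then there are `T ∈ (0, 1]`, `ε₁ > 0`, `λ₀ ≥ 1` with
`λ₀ T ≤ 1`, and iterates `v_k` (`v_0 = 0`) on `[0, T]` such that: every `v_k` is
chart-slab-smooth with `v_k(0) = 0`; `∂ₜ v_{k+1} = L v_{k+1} + Θ(v_k)`; the energies
`E_{K₀}(cutExpr_q v_k(s)) ≤ ε₁²` at all times (`K₀ = m₀ + n'`, with `ε₁` below the smallness
threshold of order `m₀`), and `Σ_q maxRegQ_{K₀} λ₀ ŵ_q(v_k) T ≤ 1`.
[cite: TaylorPDEIII2011, Ch. 15, §7] -/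
theorem PicardData.exists_iterates {Clin : ℝ≥0∞} (hClin : Clin ≠ ⊤)
    (hLin : ∀ {T' : ℝ}, 0 < T' → T' ≤ 1 → ∀ {Θ : ℝ → M → W'},
      (∀ q, ContDiffOn ℝ ∞ (uncurry fun s y ↦ Θ s ((D.PS.chart q).inv y)) (Icc 0 T' ×ˢ (D.PS.chart q).target)) →
      ∃ v : ℝ → M → W', (∀ q, ContDiffOn ℝ ∞ (uncurry fun s y ↦ v s ((D.PS.chart q).inv y)) (Icc 0 T' ×ˢ (D.PS.chart q).target)) ∧
        (∀ x, v 0 x = 0) ∧ ∀ s ∈ Icc 0 T', ∀ x, derivWithin (fun s ↦ v s x) (Icc 0 T') s = linOp D.P D.u₀ (v s) x + Θ s x)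
    (hAp : ∀ i : ℕ, ∃ Λ : ℝ, 1 ≤ Λ ∧ ∀ {lam : ℝ}, Λ ≤ lam → ∀ {T' : ℝ}, 0 < T' → T' ≤ 1 → ∀ {v g : ℝ → M → W'},
      (∀ q, ContDiffOn ℝ ∞ (uncurry fun s y ↦ v s ((D.PS.chart q).inv y)) (Icc 0 T' ×ˢ (D.PS.chart q).target)) →
      (∀ x, v 0 x = 0) →
      (∀ q, ContDiffOn ℝ ∞ (uncurry fun s y ↦ g s ((D.PS.chart q).inv y)) (Icc 0 T' ×ˢ (D.PS.chart q).target)) →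
      (∀ s ∈ Icc 0 T', ∀ x, derivWithin (fun s ↦ v s x) (Icc 0 T') s = linOp D.P D.u₀ (v s) x + g s x) →
      ∀ t ∈ Icc 0 T',
        (∑ p, PatchSystemLoc.maxRegQ i lam (fun s ↦ PatchSystemLoc.cutExpr D.PS p (v s)) t ≤
          Clin * ∑ p, ∫⁻ s in Ioo 0 t, ENNReal.ofReal (Real.exp (-2 * lam * s)) * sobolevEnergy i (PatchSystemLoc.cutExpr D.PS p (g s))) ∧
        ∀ p, ENNReal.ofReal (Real.exp (-2 * lam * t)) * sobolevEnergy i (PatchSystemLoc.cutExpr D.PS p (v t)) ≤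
          Clin * ENNReal.ofReal lam⁻¹ * ∑ p, ∫⁻ s in Ioo 0 t, ENNReal.ofReal (Real.exp (-2 * lam * s)) * sobolevEnergy i (PatchSystemLoc.cutExpr D.PS p (g s)))
    (m₀ : ℕ) (hm₀ : 2 * (Module.finrank ℝ E' + 1) + 8 ≤ m₀) :
    ∃ T : ℝ, 0 < T ∧ T ≤ 1 ∧ ∃ ε₁ : ℝ, 0 < ε₁ ∧ ∃ lam₀ : ℝ, 1 ≤ lam₀ ∧ lam₀ * T ≤ 1 ∧
      (∃ ε₀ : ℝ, ε₁ ≤ ε₀ ∧ ∃ Cs : ℝ, 0 ≤ Cs ∧ ∃ Cδ : ℝ, 0 ≤ Cδ ∧ Cδ * ε₁ ≤ 1 ∧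
        Clin * ((Fintype.card ι : ℝ≥0∞) * ENNReal.ofReal (D.ctop * (Cδ * ε₁) ^ 2)) ≤ ENNReal.ofReal 4⁻¹ ∧
        ∀ {v : M → W'}, ContMDiff I 𝓘(ℝ, W') ∞ v → ∀ {ε : ℝ}, 0 ≤ ε → ε ≤ ε₀ →
          (∀ q, sobolevEnergy (m₀ + 2 * (Module.finrank ℝ E' + 1)) (PatchSystemLoc.cutExpr D.PS q v) ≤ ENNReal.ofReal (ε ^ 2)) →
          (∀ x, (x, D.u₀ x + v x) ∈ D.𝒪) ∧
          (∀ p y, D.PS.cut p y ≠ 0 → jetQ (jetOf (v ∘ (D.PS.chart p).inv) y) ≤ D.ρ' ^ 2) ∧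
          (∀ p, ∀ m ≤ m₀, ∀ y, ‖iteratedFDeriv ℝ m (PatchSystemLoc.zExpr D.PS p v) y‖ ≤ Cs * ε) ∧
          (∀ p i i' y, |D.Gc p i i' (y, jetOf (PatchSystemLoc.zExpr D.PS p v) y)| ≤ Cδ * ε)) ∧
      ∃ v : ℕ → ℝ → M → W',
        (∀ k q, ContDiffOn ℝ ∞ (uncurry fun s y ↦ v k s ((D.PS.chart q).inv y)) (Icc 0 T ×ˢ (D.PS.chart q).target)) ∧
        (∀ k x, v k 0 x = 0) ∧ (∀ s x, v 0 s x = 0) ∧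
        (∀ k, ∀ s ∈ Icc 0 T, ∀ x, derivWithin (fun s ↦ v (k + 1) s x) (Icc 0 T) s = linOp D.P D.u₀ (v (k + 1) s) x + D.theta (v k s) x) ∧
        (∀ k, ∀ s ∈ Icc 0 T, ∀ q, sobolevEnergy (m₀ + 2 * (Module.finrank ℝ E' + 1)) (PatchSystemLoc.cutExpr D.PS q (v k s)) ≤ ENNReal.ofReal (ε₁ ^ 2)) ∧
        (∀ k, ∑ q, PatchSystemLoc.maxRegQ (m₀ + 2 * (Module.finrank ℝ E' + 1)) lam₀ (fun s ↦ PatchSystemLoc.cutExpr D.PS q (v k s)) T ≤ 1) := by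
  classical
  /- ## constants -/
  set n' : ℕ := 2 * (Module.finrank ℝ E' + 1) with hn'
  set K₀ : ℕ := m₀ + n' with hK₀
  have hK₀m : K₀ / 2 + 3 ≤ m₀ := by omega
  obtain ⟨ε₀, hε₀, Cs, hCs0, Cδ, hCδ0, hsmall⟩ := D.small_of_energy_le m₀ (by omega)
  set R : ℝ := Cs * ε₀ with hR
  obtain ⟨B, hBtop, hB⟩ := D.sum_lintegral_energy_theta_le K₀ R
  obtain ⟨Λ, hΛ1, hap⟩ := hAp K₀
  set c : ℝ := Clin.toReal with hc
  have hc0 : 0 ≤ c := ENNReal.toReal_nonneg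
  have hClinc : Clin = ENNReal.ofReal c := (ENNReal.ofReal_toReal hClin).symm
  set b : ℝ := B.toReal with hb
  have hb0 : 0 ≤ b := ENNReal.toReal_nonneg
  have hBb : B = ENNReal.ofReal b := (ENNReal.ofReal_toReal hBtop).symm
  set cardR : ℝ := (Fintype.card ι : ℝ) with hcardR
  have hcard0 : 0 ≤ cardR := Nat.cast_nonneg _
  have hct0 : 0 ≤ D.ctop := D.ctop_nonneg
  set A : ℝ := 4 * c * cardR * D.ctop with hA
  have hA0 : 0 ≤ A := by positivity
  -- the smallness parameter
  set ε₁ : ℝ := min ε₀ (1 / ((Cδ + 1) * (A + 2))) with hε₁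
  have hε₁pos : 0 < ε₁ := lt_min hε₀ (by positivity)
  have hε₁ε₀ : ε₁ ≤ ε₀ := min_le_left _ _
  have hε₁A : ε₁ ≤ 1 / ((Cδ + 1) * (A + 2)) := min_le_right _ _
  set δ₁ : ℝ := Cδ * ε₁ with hδ₁
  have hδ₁0 : 0 ≤ δ₁ := mul_nonneg hCδ0 hε₁pos.le
  have hδ₁A : δ₁ ≤ 1 / (A + 2) := by
    rw [hδ₁]
    calc Cδ * ε₁ ≤ Cδ * (1 / ((Cδ + 1) * (A + 2))) := mul_le_mul_of_nonneg_left hε₁A hCδ0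
      _ ≤ (Cδ + 1) * (1 / ((Cδ + 1) * (A + 2))) := mul_le_mul_of_nonneg_right (by linarith) (by positivity)
      _ = 1 / (A + 2) := by field_simp
  have hδ₁1 : δ₁ ≤ 1 := hδ₁A.trans (by rw [div_le_one (by positivity)]; linarith)
  have htopR : c * cardR * D.ctop * δ₁ ^ 2 ≤ 4⁻¹ := by
    have h1 : δ₁ ^ 2 ≤ (1 / (A + 2)) ^ 2 := pow_le_pow_left₀ hδ₁0 hδ₁A 2
    have h2 : (1 / (A + 2)) ^ 2 ≤ 1 / (A + 2) := by
      rw [div_pow, one_pow]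
      exact div_le_div_of_nonneg_left zero_le_one (by positivity) (by nlinarith)
    have h3 : A / 4 * (1 / (A + 2)) ≤ 4⁻¹ := by
      rw [div_mul_eq_mul_div, mul_one_div, div_div, div_le_iff₀ (by positivity)]; nlinarith
    calc c * cardR * D.ctop * δ₁ ^ 2 = A / 4 * δ₁ ^ 2 := by rw [hA]; ring
      _ ≤ A / 4 * (1 / (A + 2)) := mul_le_mul_of_nonneg_left (h1.trans h2) (by positivity)
      _ ≤ 4⁻¹ := h3
  -- the weight parameter and the time
  set lam₀ : ℝ := max (max Λ 1) (max (4 * c * b + 1) (Real.exp 2 / ε₁ ^ 2)) with hlam₀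
  have hΛlam : Λ ≤ lam₀ := (le_max_left _ _).trans (le_max_left _ _)
  have hlam1 : 1 ≤ lam₀ := (le_max_right _ _).trans (le_max_left _ _)
  have hlam0 : 0 < lam₀ := one_pos.trans_le hlam1
  have hlamcb : 4 * c * b + 1 ≤ lam₀ := (le_max_left _ _).trans (le_max_right _ _)
  have hlame : Real.exp 2 / ε₁ ^ 2 ≤ lam₀ := (le_max_right _ _).trans (le_max_right _ _)
  have hcbR : c * b * lam₀⁻¹ ≤ 4⁻¹ := by
    rw [← div_eq_mul_inv, div_le_iff₀ hlam0]; nlinarith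
  have heR : Real.exp 2 * lam₀⁻¹ ≤ ε₁ ^ 2 := by
    rw [← div_eq_mul_inv, div_le_iff₀ hlam0]
    have h := (div_le_iff₀ (pow_pos hε₁pos 2)).1 hlame
    linarith
  set T : ℝ := lam₀⁻¹ with hT
  have hT0 : 0 < T := inv_pos.2 hlam0
  have hT1 : T ≤ 1 := inv_le_one_of_one_le₀ hlam1
  have hlamT : lam₀ * T ≤ 1 := by rw [hT, mul_inv_cancel₀ hlam0.ne']
  /- ## the key inequalities in `ℝ≥0∞` -/
  set cardE : ℝ≥0∞ := (Fintype.card ι : ℝ≥0∞) with hcardE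
  have hcardE : cardE = ENNReal.ofReal cardR := by rw [hcardE, hcardR, ENNReal.ofReal_natCast]
  set Yb : ℝ≥0∞ := cardE * ENNReal.ofReal (D.ctop * δ₁ ^ 2) + B * (ENNReal.ofReal T + ENNReal.ofReal lam₀⁻¹) with hYb
  have htopE : Clin * (cardE * ENNReal.ofReal (D.ctop * δ₁ ^ 2)) ≤ ENNReal.ofReal 4⁻¹ := by
    rw [hClinc, hcardE, ← ENNReal.ofReal_mul hcard0, ← ENNReal.ofReal_mul hc0]
    refine ENNReal.ofReal_le_ofReal ?_
    calc c * (cardR * (D.ctop * δ₁ ^ 2)) = c * cardR * D.ctop * δ₁ ^ 2 := by ring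
      _ ≤ 4⁻¹ := htopR
  have hkey : Clin * Yb ≤ 1 := by
    have h2 : Clin * (B * (ENNReal.ofReal T + ENNReal.ofReal lam₀⁻¹)) ≤ ENNReal.ofReal 2⁻¹ := by
      rw [hClinc, hBb, hT, ← ENNReal.ofReal_add (inv_nonneg.2 hlam0.le) (inv_nonneg.2 hlam0.le), ← ENNReal.ofReal_mul hb0, ← ENNReal.ofReal_mul hc0]
      refine ENNReal.ofReal_le_ofReal ?_
      calc c * (b * (lam₀⁻¹ + lam₀⁻¹)) = 2 * (c * b * lam₀⁻¹) := by ring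
        _ ≤ 2 * 4⁻¹ := by nlinarith
        _ = 2⁻¹ := by norm_num
    calc Clin * Yb = Clin * (cardE * ENNReal.ofReal (D.ctop * δ₁ ^ 2)) + Clin * (B * (ENNReal.ofReal T + ENNReal.ofReal lam₀⁻¹)) := by rw [hYb, mul_add]
      _ ≤ ENNReal.ofReal 4⁻¹ + ENNReal.ofReal 2⁻¹ := add_le_add htopE h2
      _ = ENNReal.ofReal (4⁻¹ + 2⁻¹) := (ENNReal.ofReal_add (by norm_num) (by norm_num)).symm
      _ ≤ 1 := by rw [← ENNReal.ofReal_one]; exact ENNReal.ofReal_le_ofReal (by norm_num)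
  have hkey2 : ∀ t ∈ Icc 0 T, ENNReal.ofReal (Real.exp (2 * lam₀ * t)) * (Clin * ENNReal.ofReal lam₀⁻¹ * Yb) ≤ ENNReal.ofReal (ε₁ ^ 2) := by
    intro t ht
    have h1 : Real.exp (2 * lam₀ * t) ≤ Real.exp 2 := by
      refine Real.exp_le_exp.2 ?_
      have : lam₀ * t ≤ 1 := (mul_le_mul_of_nonneg_left ht.2 hlam0.le).trans hlamT
      nlinarith
    calc ENNReal.ofReal (Real.exp (2 * lam₀ * t)) * (Clin * ENNReal.ofReal lam₀⁻¹ * Yb)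
        = ENNReal.ofReal (Real.exp (2 * lam₀ * t)) * ENNReal.ofReal lam₀⁻¹ * (Clin * Yb) := by ring
      _ ≤ ENNReal.ofReal (Real.exp 2) * ENNReal.ofReal lam₀⁻¹ * 1 := mul_le_mul' (mul_le_mul' (ENNReal.ofReal_le_ofReal h1) le_rfl) hkey
      _ = ENNReal.ofReal (Real.exp 2 * lam₀⁻¹) := by rw [mul_one, ← ENNReal.ofReal_mul (Real.exp_pos _).le]
      _ ≤ ENNReal.ofReal (ε₁ ^ 2) := ENNReal.ofReal_le_ofReal heR
  /- ## the invariant and its consequences -/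
  have hcons : ∀ {v : ℝ → M → W'}, (∀ q, ContDiffOn ℝ ∞ (uncurry fun s y ↦ v s ((D.PS.chart q).inv y)) (Icc 0 T ×ˢ (D.PS.chart q).target)) →
      (∀ s ∈ Icc 0 T, ∀ q, sobolevEnergy K₀ (PatchSystemLoc.cutExpr D.PS q (v s)) ≤ ENNReal.ofReal (ε₁ ^ 2)) →
      ∀ s ∈ Icc 0 T, ContMDiff I 𝓘(ℝ, W') ∞ (v s) ∧ (∀ x, (x, D.u₀ x + v s x) ∈ D.𝒪) ∧
        (∀ p y, D.PS.cut p y ≠ 0 → jetQ (jetOf (v s ∘ (D.PS.chart p).inv) y) ≤ D.ρ' ^ 2) ∧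
        (∀ p, ∀ m ≤ K₀ / 2 + 3, ∀ y, ‖iteratedFDeriv ℝ m (PatchSystemLoc.zExpr D.PS p (v s)) y‖ ≤ R) ∧
        (∀ p i i' y, |D.Gc p i i' (y, jetOf (PatchSystemLoc.zExpr D.PS p (v s)) y)| ≤ δ₁) := by
    intro v hv hE s hs
    have hvs : ContMDiff I 𝓘(ℝ, W') ∞ (v s) := PatchSystemLoc.contMDiff_of_chartSmooth D.PS (PatchSystemLoc.chartSmooth_slice D.PS hv hs)
    obtain ⟨hg, hj, hsup, hδ⟩ := hsmall hvs hε₁pos.le hε₁ε₀ (hE s hs)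
    refine ⟨hvs, hg, hj, fun p m hm y ↦ (hsup p m (hm.trans hK₀m) y).trans ?_, fun p i i' y ↦ hδ p i i' y⟩
    exact mul_le_mul_of_nonneg_left hε₁ε₀ hCs0
  /- ## the step -/
  -- the invariant as a predicate on families
  have hstep : ∀ v : ℝ → M → W', ((∀ q, ContDiffOn ℝ ∞ (uncurry fun s y ↦ v s ((D.PS.chart q).inv y)) (Icc 0 T ×ˢ (D.PS.chart q).target)) ∧
      (∀ x, v 0 x = 0) ∧ (∀ s ∈ Icc 0 T, ∀ q, sobolevEnergy K₀ (PatchSystemLoc.cutExpr D.PS q (v s)) ≤ ENNReal.ofReal (ε₁ ^ 2)) ∧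
      ∑ q, PatchSystemLoc.maxRegQ K₀ lam₀ (fun s ↦ PatchSystemLoc.cutExpr D.PS q (v s)) T ≤ 1) →
      ∃ v' : ℝ → M → W', ((∀ q, ContDiffOn ℝ ∞ (uncurry fun s y ↦ v' s ((D.PS.chart q).inv y)) (Icc 0 T ×ˢ (D.PS.chart q).target)) ∧
        (∀ x, v' 0 x = 0) ∧ (∀ s ∈ Icc 0 T, ∀ q, sobolevEnergy K₀ (PatchSystemLoc.cutExpr D.PS q (v' s)) ≤ ENNReal.ofReal (ε₁ ^ 2)) ∧
        ∑ q, PatchSystemLoc.maxRegQ K₀ lam₀ (fun s ↦ PatchSystemLoc.cutExpr D.PS q (v' s)) T ≤ 1) ∧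
        ∀ s ∈ Icc 0 T, ∀ x, derivWithin (fun s ↦ v' s x) (Icc 0 T) s = linOp D.P D.u₀ (v' s) x + D.theta (v s) x := by
    intro v ⟨hv, hv0, hE, hQ⟩
    have hc' := hcons hv hE
    have hvs : ∀ s ∈ Icc 0 T, ContMDiff I 𝓘(ℝ, W') ∞ (v s) := fun s hs ↦ (hc' s hs).1
    have hgv : ∀ s ∈ Icc 0 T, ∀ x, (x, D.u₀ x + v s x) ∈ D.𝒪 := fun s hs ↦ (hc' s hs).2.1
    have hΘ := D.theta_chartSlabSmooth' hT0 hv hvs hgv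
    obtain ⟨v', hv's, hv'0, hv'eq⟩ := hLin hT0 hT1 hΘ
    have hen := fun t ht ↦ hap hΛlam hT0 hT1 hv's hv'0 hΘ hv'eq t ht
    -- the source integral
    have hY : ∀ t ∈ Icc 0 T, ∑ p, (∫⁻ s in Ioo 0 t, ENNReal.ofReal (Real.exp (-2 * lam₀ * s)) * sobolevEnergy K₀ (PatchSystemLoc.cutExpr D.PS p (D.theta (v s)))) ≤ Yb := by
      intro t ht
      have h := hB hT0 hv hvs hgv (fun s hs ↦ (hc' s hs).2.2.1) (fun s hs ↦ (hc' s hs).2.2.2.1) hδ₁0 hδ₁1 (fun s hs ↦ (hc' s hs).2.2.2.2) hlam1 t ht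
      refine h.trans ?_
      have hQt : ∑ q, PatchSystemLoc.maxRegQ K₀ lam₀ (fun s ↦ PatchSystemLoc.cutExpr D.PS q (v s)) t ≤ 1 :=
        (Finset.sum_le_sum fun q _ ↦ PatchSystemLoc.maxRegQ_mono_time K₀ lam₀ _ ht.2).trans hQ
      rw [hYb]
      refine add_le_add ?_ (mul_le_mul' le_rfl (add_le_add (ENNReal.ofReal_le_ofReal ht.2) ?_))
      · calc _ ≤ cardE * ENNReal.ofReal (D.ctop * δ₁ ^ 2) * 1 := mul_le_mul' le_rfl hQt
          _ = _ := mul_one _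
      · calc _ ≤ ENNReal.ofReal lam₀⁻¹ * 1 := mul_le_mul' le_rfl hQt
          _ = _ := mul_one _
    refine ⟨v', ⟨hv's, hv'0, fun s hs q ↦ ?_, ?_⟩, hv'eq⟩
    · -- the pointwise energy bound
      have h := ((hen s hs).2 q).trans (mul_le_mul' le_rfl (hY s hs))
      have hexp : ENNReal.ofReal (Real.exp (2 * lam₀ * s)) * ENNReal.ofReal (Real.exp (-2 * lam₀ * s)) = 1 := by
        rw [← ENNReal.ofReal_mul (Real.exp_pos _).le, ← Real.exp_add]; norm_num
      calc sobolevEnergy K₀ (PatchSystemLoc.cutExpr D.PS q (v' s))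
          = ENNReal.ofReal (Real.exp (2 * lam₀ * s)) * (ENNReal.ofReal (Real.exp (-2 * lam₀ * s)) * sobolevEnergy K₀ (PatchSystemLoc.cutExpr D.PS q (v' s))) := by
            rw [← mul_assoc, hexp, one_mul]
        _ ≤ ENNReal.ofReal (Real.exp (2 * lam₀ * s)) * (Clin * ENNReal.ofReal lam₀⁻¹ * Yb) := mul_le_mul' le_rfl h
        _ ≤ ENNReal.ofReal (ε₁ ^ 2) := hkey2 s hs
    · exact ((hen T ⟨hT0.le, le_rfl⟩).1.trans (mul_le_mul' le_rfl (hY T ⟨hT0.le, le_rfl⟩))).trans hkey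
  /- ## the sequence -/
  choose stepF hstepInv hstepEq using hstep
  have hInv0 : (∀ q, ContDiffOn ℝ ∞ (uncurry fun s y ↦ (fun (_ : ℝ) (_ : M) ↦ (0 : W')) s ((D.PS.chart q).inv y)) (Icc 0 T ×ˢ (D.PS.chart q).target)) ∧
      (∀ x : M, (fun (_ : ℝ) (_ : M) ↦ (0 : W')) 0 x = 0) ∧
      (∀ s ∈ Icc 0 T, ∀ q, sobolevEnergy K₀ (PatchSystemLoc.cutExpr D.PS q ((fun (_ : ℝ) (_ : M) ↦ (0 : W')) s)) ≤ ENNReal.ofReal (ε₁ ^ 2)) ∧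
      ∑ q, PatchSystemLoc.maxRegQ K₀ lam₀ (fun s ↦ PatchSystemLoc.cutExpr D.PS q ((fun (_ : ℝ) (_ : M) ↦ (0 : W')) s)) T ≤ 1 := by
    refine ⟨fun q ↦ contDiffOn_const, fun x ↦ rfl, fun s hs q ↦ ?_, ?_⟩
    · simp only [PatchSystemLoc.cutExpr_zero_fun, sobolevEnergy_zero_fun]; exact bot_le
    · simp only [PatchSystemLoc.cutExpr_zero_fun, PatchSystemLoc.maxRegQ_zero_fun, Finset.sum_const_zero]; exact bot_le
  -- iterate on the subtype of families satisfying the invariant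
  set Inv : (ℝ → M → W') → Prop := fun v ↦ (∀ q, ContDiffOn ℝ ∞ (uncurry fun s y ↦ v s ((D.PS.chart q).inv y)) (Icc 0 T ×ˢ (D.PS.chart q).target)) ∧
      (∀ x, v 0 x = 0) ∧ (∀ s ∈ Icc 0 T, ∀ q, sobolevEnergy K₀ (PatchSystemLoc.cutExpr D.PS q (v s)) ≤ ENNReal.ofReal (ε₁ ^ 2)) ∧
      ∑ q, PatchSystemLoc.maxRegQ K₀ lam₀ (fun s ↦ PatchSystemLoc.cutExpr D.PS q (v s)) T ≤ 1 with hInv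
  let seq : ℕ → {v : ℝ → M → W' // Inv v} := fun k ↦ Nat.rec ⟨fun _ _ ↦ 0, hInv0⟩ (fun _ w ↦ ⟨stepF w.1 w.2, hstepInv w.1 w.2⟩) k
  have hseq0 : (seq 0).1 = fun _ _ ↦ 0 := rfl
  have hseqS : ∀ k, (seq (k + 1)).1 = stepF (seq k).1 (seq k).2 := fun k ↦ rfl
  refine ⟨T, hT0, hT1, ε₁, hε₁pos, lam₀, hlam1, hlamT, ⟨ε₀, hε₁ε₀, Cs, hCs0, Cδ, hCδ0, hδ₁1, htopE, fun hv ε hε hεε₀ hEv ↦ hsmall hv hε hεε₀ hEv⟩,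
    fun k ↦ (seq k).1, fun k ↦ (seq k).2.1, fun k ↦ (seq k).2.2.1, fun s x ↦ ?_, fun k s hs x ↦ ?_, fun k ↦ (seq k).2.2.2.1, fun k ↦ (seq k).2.2.2.2⟩
  · show (seq 0).1 s x = 0
    rw [hseq0]
  · show derivWithin (fun s ↦ (seq (k + 1)).1 s x) (Icc 0 T) s = linOp D.P D.u₀ ((seq (k + 1)).1 s) x + D.theta ((seq k).1 s) x
    rw [hseqS]
    exact hstepEq (seq k).1 (seq k).2 s hs x

/-! ### Boundedness of the iterates at all orders -/

set_option maxHeartbeats 3200000 in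
/-- **Boundedness of the Picard iterates at every order.** In the situation of `exists_iterates`
(iterates `v_k` on `[0, T]`, `T ≤ 1`, with the base-level smallness), for every order `K ≥ K₀`
there are a weight `λ_K ≥ 1`, a bound of `Σ_q maxRegQ_K λ_K ŵ_q(v_k) T` and a bound of the energies
`E_K(cutExpr_q v_k(s))`, both uniform in `k` and `s`. The top-order smallness used at order `K` is
the base-level one, thanks to the order-independence of the constants `C_lin` and `c_top`.
[cite: TaylorPDEIII2011, Ch. 15, §7] -/
theorem PicardData.iterates_bounded {Clin : ℝ≥0∞} (hClin : Clin ≠ ⊤)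
    (hAp : ∀ i : ℕ, ∃ Λ : ℝ, 1 ≤ Λ ∧ ∀ {lam : ℝ}, Λ ≤ lam → ∀ {T' : ℝ}, 0 < T' → T' ≤ 1 → ∀ {v g : ℝ → M → W'},
      (∀ q, ContDiffOn ℝ ∞ (uncurry fun s y ↦ v s ((D.PS.chart q).inv y)) (Icc 0 T' ×ˢ (D.PS.chart q).target)) →
      (∀ x, v 0 x = 0) →
      (∀ q, ContDiffOn ℝ ∞ (uncurry fun s y ↦ g s ((D.PS.chart q).inv y)) (Icc 0 T' ×ˢ (D.PS.chart q).target)) →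
      (∀ s ∈ Icc 0 T', ∀ x, derivWithin (fun s ↦ v s x) (Icc 0 T') s = linOp D.P D.u₀ (v s) x + g s x) →
      ∀ t ∈ Icc 0 T',
        (∑ p, PatchSystemLoc.maxRegQ i lam (fun s ↦ PatchSystemLoc.cutExpr D.PS p (v s)) t ≤
          Clin * ∑ p, ∫⁻ s in Ioo 0 t, ENNReal.ofReal (Real.exp (-2 * lam * s)) * sobolevEnergy i (PatchSystemLoc.cutExpr D.PS p (g s))) ∧
        ∀ p, ENNReal.ofReal (Real.exp (-2 * lam * t)) * sobolevEnergy i (PatchSystemLoc.cutExpr D.PS p (v t)) ≤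
          Clin * ENNReal.ofReal lam⁻¹ * ∑ p, ∫⁻ s in Ioo 0 t, ENNReal.ofReal (Real.exp (-2 * lam * s)) * sobolevEnergy i (PatchSystemLoc.cutExpr D.PS p (g s)))
    {m₀ : ℕ} (hm₀ : 2 * (Module.finrank ℝ E' + 1) + 8 ≤ m₀) {T : ℝ} (hT0 : 0 < T) (hT1 : T ≤ 1) {ε₁ : ℝ} (hε₁ : 0 < ε₁)
    {ε₀ : ℝ} (hε₁ε₀ : ε₁ ≤ ε₀) {Cs Cδ : ℝ} (hCδ0 : 0 ≤ Cδ) (hδ1 : Cδ * ε₁ ≤ 1)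
    (htop : Clin * ((Fintype.card ι : ℝ≥0∞) * ENNReal.ofReal (D.ctop * (Cδ * ε₁) ^ 2)) ≤ ENNReal.ofReal 4⁻¹)
    (hsmall : ∀ {v : M → W'}, ContMDiff I 𝓘(ℝ, W') ∞ v → ∀ {ε : ℝ}, 0 ≤ ε → ε ≤ ε₀ →
      (∀ q, sobolevEnergy (m₀ + 2 * (Module.finrank ℝ E' + 1)) (PatchSystemLoc.cutExpr D.PS q v) ≤ ENNReal.ofReal (ε ^ 2)) →
      (∀ x, (x, D.u₀ x + v x) ∈ D.𝒪) ∧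
      (∀ p y, D.PS.cut p y ≠ 0 → jetQ (jetOf (v ∘ (D.PS.chart p).inv) y) ≤ D.ρ' ^ 2) ∧
      (∀ p, ∀ m ≤ m₀, ∀ y, ‖iteratedFDeriv ℝ m (PatchSystemLoc.zExpr D.PS p v) y‖ ≤ Cs * ε) ∧
      (∀ p i i' y, |D.Gc p i i' (y, jetOf (PatchSystemLoc.zExpr D.PS p v) y)| ≤ Cδ * ε))
    {v : ℕ → ℝ → M → W'}
    (hvs : ∀ k q, ContDiffOn ℝ ∞ (uncurry fun s y ↦ v k s ((D.PS.chart q).inv y)) (Icc 0 T ×ˢ (D.PS.chart q).target))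
    (hv0 : ∀ k x, v k 0 x = 0) (hv00 : ∀ s x, v 0 s x = 0)
    (heq : ∀ k, ∀ s ∈ Icc 0 T, ∀ x, derivWithin (fun s ↦ v (k + 1) s x) (Icc 0 T) s = linOp D.P D.u₀ (v (k + 1) s) x + D.theta (v k s) x)
    (hE0 : ∀ k, ∀ s ∈ Icc 0 T, ∀ q, sobolevEnergy (m₀ + 2 * (Module.finrank ℝ E' + 1)) (PatchSystemLoc.cutExpr D.PS q (v k s)) ≤ ENNReal.ofReal (ε₁ ^ 2))
    (K : ℕ) (hK : m₀ + 2 * (Module.finrank ℝ E' + 1) ≤ K) :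
    ∃ RE : ℝ, 0 ≤ RE ∧ ∀ k, ∀ s ∈ Icc 0 T, ∀ q, sobolevEnergy K (PatchSystemLoc.cutExpr D.PS q (v k s)) ≤ ENNReal.ofReal RE := by
  classical
  set n' : ℕ := 2 * (Module.finrank ℝ E' + 1) with hn'
  have hslices : ∀ k, ∀ s ∈ Icc 0 T, ContMDiff I 𝓘(ℝ, W') ∞ (v k s) ∧ (∀ x, (x, D.u₀ x + v k s x) ∈ D.𝒪) ∧
      (∀ p y, D.PS.cut p y ≠ 0 → jetQ (jetOf (v k s ∘ (D.PS.chart p).inv) y) ≤ D.ρ' ^ 2) ∧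
      (∀ p i i' y, |D.Gc p i i' (y, jetOf (PatchSystemLoc.zExpr D.PS p (v k s)) y)| ≤ Cδ * ε₁) := by
    intro k s hs
    have hvsm : ContMDiff I 𝓘(ℝ, W') ∞ (v k s) := PatchSystemLoc.contMDiff_of_chartSmooth D.PS (PatchSystemLoc.chartSmooth_slice D.PS (hvs k) hs)
    obtain ⟨hg, hj, -, hδ⟩ := hsmall hvsm hε₁.le hε₁ε₀ (hE0 k s hs)
    exact ⟨hvsm, hg, hj, hδ⟩
  have hc0 : 0 ≤ Clin.toReal := ENNReal.toReal_nonneg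
  have hClinc : Clin = ENNReal.ofReal Clin.toReal := (ENNReal.ofReal_toReal hClin).symm
  have hδ₁0 : 0 ≤ Cδ * ε₁ := mul_nonneg hCδ0 hε₁.le
  induction K, hK using Nat.le_induction with
  | base => exact ⟨ε₁ ^ 2, sq_nonneg _, hE0⟩
  | succ K hKle ih =>
    obtain ⟨RE, hRE0, hRE⟩ := ih
    -- sup bounds of the low derivatives from the order-`K` energies
    set m' : ℕ := (K + 1) / 2 + 3 with hm'
    have hm'K : m' + n' ≤ K := by omega
    obtain ⟨Cs', hCs'0, hCs'⟩ := PatchSystemLoc.norm_iteratedFDeriv_zExpr_le D.PS (F' := W') m'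
    set R' : ℝ := Cs' * Real.sqrt RE with hR'
    have hsup : ∀ k, ∀ s ∈ Icc 0 T, ∀ p, ∀ m ≤ (K + 1) / 2 + 3, ∀ y, ‖iteratedFDeriv ℝ m (PatchSystemLoc.zExpr D.PS p (v k s)) y‖ ≤ R' := by
      intro k s hs p m hm y
      refine hCs' p (PatchSystemLoc.chartSmooth_slice D.PS (hvs k) hs) (Real.sqrt_nonneg RE) (fun q ↦ ?_) m hm y
      rw [Real.sq_sqrt hRE0]
      exact (sobolevEnergy_mono hm'K _).trans (hRE k s hs q)
    -- the constants of the order `K + 1`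
    obtain ⟨B', hB'top, hB'⟩ := D.sum_lintegral_energy_theta_le (K + 1) R'
    obtain ⟨Λ', hΛ'1, hap'⟩ := hAp (K + 1)
    have hb0 : 0 ≤ B'.toReal := ENNReal.toReal_nonneg
    have hBb : B' = ENNReal.ofReal B'.toReal := (ENNReal.ofReal_toReal hB'top).symm
    set lam : ℝ := max Λ' (4 * Clin.toReal * B'.toReal + 1) with hlam
    have hΛlam : Λ' ≤ lam := le_max_left _ _
    have hlam1 : 1 ≤ lam := hΛ'1.trans hΛlam
    have hlam0 : 0 < lam := one_pos.trans_le hlam1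
    have hlamcb : 4 * Clin.toReal * B'.toReal + 1 ≤ lam := le_max_right _ _
    have hlow : Clin * (B' * ENNReal.ofReal lam⁻¹) ≤ ENNReal.ofReal 4⁻¹ := by
      rw [hClinc, hBb, ← ENNReal.ofReal_mul hb0, ← ENNReal.ofReal_mul hc0]
      refine ENNReal.ofReal_le_ofReal ?_
      rw [← mul_assoc, ← div_eq_mul_inv, div_le_iff₀ hlam0]; nlinarith
    -- the recursion for `X k = Σ_q maxRegQ_{K+1} λ ŵ_q(v_k) T`
    set X : ℕ → ℝ≥0∞ := fun k ↦ ∑ q, PatchSystemLoc.maxRegQ (K + 1) lam (fun s ↦ PatchSystemLoc.cutExpr D.PS q (v k s)) T with hX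
    set Z : ℝ≥0∞ := Clin * B' * ENNReal.ofReal T with hZ
    have hZtop : Z ≠ ⊤ := ENNReal.mul_ne_top (ENNReal.mul_ne_top hClin hB'top) ENNReal.ofReal_ne_top
    set cδ : ℝ≥0∞ := (Fintype.card ι : ℝ≥0∞) * ENNReal.ofReal (D.ctop * (Cδ * ε₁) ^ 2) with hcδ
    have hY : ∀ k, ∀ t ∈ Icc 0 T, ∑ p, (∫⁻ s in Ioo 0 t, ENNReal.ofReal (Real.exp (-2 * lam * s)) * sobolevEnergy (K + 1) (PatchSystemLoc.cutExpr D.PS p (D.theta (v k s)))) ≤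
        cδ * X k + B' * (ENNReal.ofReal T + ENNReal.ofReal lam⁻¹ * X k) := by
      intro k t ht
      have h := hB' hT0 (hvs k) (fun s hs ↦ (hslices k s hs).1) (fun s hs ↦ (hslices k s hs).2.1) (fun s hs ↦ (hslices k s hs).2.2.1)
        (hsup k) hδ₁0 hδ1 (fun s hs ↦ (hslices k s hs).2.2.2) hlam1 t ht
      refine h.trans ?_
      have hQt : ∑ q, PatchSystemLoc.maxRegQ (K + 1) lam (fun s ↦ PatchSystemLoc.cutExpr D.PS q (v k s)) t ≤ X k :=
        Finset.sum_le_sum fun q _ ↦ PatchSystemLoc.maxRegQ_mono_time (K + 1) lam _ ht.2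
      exact add_le_add (mul_le_mul' le_rfl hQt) (mul_le_mul' le_rfl (add_le_add (ENNReal.ofReal_le_ofReal ht.2) (mul_le_mul' le_rfl hQt)))
    have hrec : ∀ k, X (k + 1) ≤ ENNReal.ofReal 4⁻¹ * X k + ENNReal.ofReal 4⁻¹ * X k + Z := by
      intro k
      have hΘ := D.theta_chartSlabSmooth' hT0 (hvs k) (fun s hs ↦ (hslices k s hs).1) (fun s hs ↦ (hslices k s hs).2.1)
      have hen := (hap' hΛlam hT0 hT1 (hvs (k + 1)) (hv0 (k + 1)) hΘ (heq k) T ⟨hT0.le, le_rfl⟩).1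
      calc X (k + 1) ≤ Clin * (cδ * X k + B' * (ENNReal.ofReal T + ENNReal.ofReal lam⁻¹ * X k)) := hen.trans (mul_le_mul' le_rfl (hY k T ⟨hT0.le, le_rfl⟩))
        _ = Clin * cδ * X k + Clin * (B' * ENNReal.ofReal lam⁻¹) * X k + Clin * B' * ENNReal.ofReal T := by ring
        _ ≤ ENNReal.ofReal 4⁻¹ * X k + ENNReal.ofReal 4⁻¹ * X k + Z := add_le_add (add_le_add (mul_le_mul' htop le_rfl) (mul_le_mul' hlow le_rfl)) le_rfl
    have hX0 : X 0 = 0 := by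
      simp only [hX]
      refine Finset.sum_eq_zero fun q _ ↦ ?_
      have hf : (fun s ↦ PatchSystemLoc.cutExpr D.PS q (v 0 s)) = fun (_ : ℝ) (_ : E') ↦ (0 : W') := by
        funext s
        have : v 0 s = fun _ ↦ 0 := funext fun x ↦ hv00 s x
        rw [this, PatchSystemLoc.cutExpr_zero_fun]
      rw [hf, PatchSystemLoc.maxRegQ_zero_fun]
    have hquarter : ENNReal.ofReal 4⁻¹ * (2 * Z) + ENNReal.ofReal 4⁻¹ * (2 * Z) + Z = 2 * Z := by
      have h : ENNReal.ofReal 4⁻¹ * (2 * Z) + ENNReal.ofReal 4⁻¹ * (2 * Z) = (ENNReal.ofReal 4⁻¹ * 4) * Z := by ring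
      have h4 : ENNReal.ofReal 4⁻¹ * 4 = 1 := by
        rw [← ENNReal.ofReal_ofNat 4, ← ENNReal.ofReal_mul (by norm_num)]; norm_num
      rw [h, h4, one_mul]; ring
    have hXb : ∀ k, X k ≤ 2 * Z := by
      intro k
      induction k with
      | zero => rw [hX0]; exact bot_le
      | succ k ihk =>
        calc X (k + 1) ≤ ENNReal.ofReal 4⁻¹ * X k + ENNReal.ofReal 4⁻¹ * X k + Z := hrec k
          _ ≤ ENNReal.ofReal 4⁻¹ * (2 * Z) + ENNReal.ofReal 4⁻¹ * (2 * Z) + Z := add_le_add (add_le_add (mul_le_mul' le_rfl ihk) (mul_le_mul' le_rfl ihk)) le_rfl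
          _ = 2 * Z := hquarter
    -- the unweighted energies of order `K + 1`
    set REE : ℝ≥0∞ := ENNReal.ofReal (Real.exp (2 * lam * T)) * (Clin * ENNReal.ofReal lam⁻¹ * (cδ * (2 * Z) + B' * (ENNReal.ofReal T + ENNReal.ofReal lam⁻¹ * (2 * Z)))) with hREE
    have hREEtop : REE ≠ ⊤ := by
      refine ENNReal.mul_ne_top ENNReal.ofReal_ne_top (ENNReal.mul_ne_top (ENNReal.mul_ne_top hClin ENNReal.ofReal_ne_top) (ENNReal.add_ne_top.2 ⟨?_, ?_⟩))
      · exact ENNReal.mul_ne_top (ENNReal.mul_ne_top (ENNReal.natCast_ne_top _) ENNReal.ofReal_ne_top) (ENNReal.mul_ne_top (by norm_num) hZtop)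
      · exact ENNReal.mul_ne_top hB'top (ENNReal.add_ne_top.2 ⟨ENNReal.ofReal_ne_top, ENNReal.mul_ne_top ENNReal.ofReal_ne_top (ENNReal.mul_ne_top (by norm_num) hZtop)⟩)
    refine ⟨REE.toReal, ENNReal.toReal_nonneg, fun k s hs q ↦ ?_⟩
    rw [ENNReal.ofReal_toReal hREEtop]
    rcases k with _ | k
    · -- `v 0 = 0`
      have : v 0 s = fun _ ↦ 0 := funext fun x ↦ hv00 s x
      rw [this, PatchSystemLoc.cutExpr_zero_fun, sobolevEnergy_zero_fun]; exact bot_le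
    · have hΘ := D.theta_chartSlabSmooth' hT0 (hvs k) (fun s hs ↦ (hslices k s hs).1) (fun s hs ↦ (hslices k s hs).2.1)
      have hpt := ((hap' hΛlam hT0 hT1 (hvs (k + 1)) (hv0 (k + 1)) hΘ (heq k) s hs).2 q).trans
        (mul_le_mul' le_rfl ((hY k s hs).trans (add_le_add (mul_le_mul' le_rfl (hXb k)) (mul_le_mul' le_rfl (add_le_add le_rfl (mul_le_mul' le_rfl (hXb k)))))))
      have hexp : ENNReal.ofReal (Real.exp (2 * lam * s)) * ENNReal.ofReal (Real.exp (-2 * lam * s)) = 1 := by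
        rw [← ENNReal.ofReal_mul (Real.exp_pos _).le, ← Real.exp_add]; norm_num
      have hes : ENNReal.ofReal (Real.exp (2 * lam * s)) ≤ ENNReal.ofReal (Real.exp (2 * lam * T)) :=
        ENNReal.ofReal_le_ofReal (Real.exp_le_exp.2 (by nlinarith [hs.2, hlam0.le]))
      calc sobolevEnergy (K + 1) (PatchSystemLoc.cutExpr D.PS q (v (k + 1) s))
          = ENNReal.ofReal (Real.exp (2 * lam * s)) * (ENNReal.ofReal (Real.exp (-2 * lam * s)) * sobolevEnergy (K + 1) (PatchSystemLoc.cutExpr D.PS q (v (k + 1) s))) := by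
            rw [← mul_assoc, hexp, one_mul]
        _ ≤ ENNReal.ofReal (Real.exp (2 * lam * T)) * (Clin * ENNReal.ofReal lam⁻¹ * (cδ * (2 * Z) + B' * (ENNReal.ofReal T + ENNReal.ofReal lam⁻¹ * (2 * Z)))) :=
            mul_le_mul' hes hpt
        _ = REE := rfl

/-! ### Contraction: geometric decay of the differences at every order -/

omit [FiniteDimensional ℝ E'] [MeasurableSpace E'] [BorelSpace E'] [FiniteDimensional ℝ W'] [I.Boundaryless] [HasContDiffBump E'] [CompactSpace M] [T2Space M]
  [IsManifold I ∞ M] in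
/-- Time lines of a chart-slab-smooth family are differentiable within the slab. [folklore] -/
theorem PatchSystemLoc.differentiableWithinAt_time (PS : PatchSystem I M E' ι) {T : ℝ} {v : ℝ → M → W'}
    (hv : ∀ q, ContDiffOn ℝ ∞ (uncurry fun s y ↦ v s ((PS.chart q).inv y)) (Icc 0 T ×ˢ (PS.chart q).target)) {s : ℝ} (hs : s ∈ Icc 0 T) (x : M) :
    DifferentiableWithinAt ℝ (fun s ↦ v s x) (Icc 0 T) s := by
  obtain ⟨p, hxp, -⟩ := PS.cover x
  have hy : (PS.chart p).map x ∈ (PS.chart p).target := (PS.chart p).map_mem_target hxp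
  have h1 : ContDiffWithinAt ℝ ∞ (uncurry fun s y ↦ v s ((PS.chart p).inv y)) (Icc 0 T ×ˢ (PS.chart p).target) (s, (PS.chart p).map x) :=
    hv p (s, (PS.chart p).map x) (mk_mem_prod hs hy)
  have h2 : ContDiffWithinAt ℝ ∞ (fun s : ℝ ↦ (uncurry fun s y ↦ v s ((PS.chart p).inv y)) (s, (PS.chart p).map x)) (Icc 0 T) s :=
    h1.comp s (contDiffWithinAt_id.prodMk contDiffWithinAt_const) fun s' hs' ↦ mk_mem_prod hs' hy
  have h3 : (fun s : ℝ ↦ (uncurry fun s y ↦ v s ((PS.chart p).inv y)) (s, (PS.chart p).map x)) = fun s ↦ v s x := by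
    funext s'; simp [(PS.chart p).inv_map hxp]
  rw [h3] at h2
  exact h2.differentiableWithinAt (by simp)

set_option maxHeartbeats 3200000 in
/-- **Contraction of the Picard scheme at every order.** In the situation of `exists_iterates`,
with `L` linear on chart-smooth maps, for every order `K ≥ K₀` the energies of the differences of
consecutive iterates decay geometrically, uniformly in time:
`E_K(cutExpr_q (v_{k+1}(t) - v_k(t))) ≤ C_K 2^{-k}`. [cite: TaylorPDEIII2011, Ch. 15, §7] -/
theorem PicardData.iterates_contract {Clin : ℝ≥0∞} (hClin : Clin ≠ ⊤)
    (hAp : ∀ i : ℕ, ∃ Λ : ℝ, 1 ≤ Λ ∧ ∀ {lam : ℝ}, Λ ≤ lam → ∀ {T' : ℝ}, 0 < T' → T' ≤ 1 → ∀ {v g : ℝ → M → W'},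
      (∀ q, ContDiffOn ℝ ∞ (uncurry fun s y ↦ v s ((D.PS.chart q).inv y)) (Icc 0 T' ×ˢ (D.PS.chart q).target)) →
      (∀ x, v 0 x = 0) →
      (∀ q, ContDiffOn ℝ ∞ (uncurry fun s y ↦ g s ((D.PS.chart q).inv y)) (Icc 0 T' ×ˢ (D.PS.chart q).target)) →
      (∀ s ∈ Icc 0 T', ∀ x, derivWithin (fun s ↦ v s x) (Icc 0 T') s = linOp D.P D.u₀ (v s) x + g s x) →
      ∀ t ∈ Icc 0 T',
        (∑ p, PatchSystemLoc.maxRegQ i lam (fun s ↦ PatchSystemLoc.cutExpr D.PS p (v s)) t ≤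
          Clin * ∑ p, ∫⁻ s in Ioo 0 t, ENNReal.ofReal (Real.exp (-2 * lam * s)) * sobolevEnergy i (PatchSystemLoc.cutExpr D.PS p (g s))) ∧
        ∀ p, ENNReal.ofReal (Real.exp (-2 * lam * t)) * sobolevEnergy i (PatchSystemLoc.cutExpr D.PS p (v t)) ≤
          Clin * ENNReal.ofReal lam⁻¹ * ∑ p, ∫⁻ s in Ioo 0 t, ENNReal.ofReal (Real.exp (-2 * lam * s)) * sobolevEnergy i (PatchSystemLoc.cutExpr D.PS p (g s)))
    (hLsub : ∀ u u' : M → W', (∀ q, ContDiffOn ℝ ∞ (u ∘ (D.PS.chart q).inv) (D.PS.chart q).target) →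
      (∀ q, ContDiffOn ℝ ∞ (u' ∘ (D.PS.chart q).inv) (D.PS.chart q).target) →
      ∀ x, linOp D.P D.u₀ (fun x ↦ u x - u' x) x = linOp D.P D.u₀ u x - linOp D.P D.u₀ u' x)
    {m₀ : ℕ} (hm₀ : 2 * (Module.finrank ℝ E' + 1) + 8 ≤ m₀) {T : ℝ} (hT0 : 0 < T) (hT1 : T ≤ 1) {ε₁ : ℝ} (hε₁ : 0 < ε₁)
    {ε₀ : ℝ} (hε₁ε₀ : ε₁ ≤ ε₀) {Cs Cδ : ℝ} (hCδ0 : 0 ≤ Cδ) (hδ1 : Cδ * ε₁ ≤ 1)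
    (htop : Clin * ((Fintype.card ι : ℝ≥0∞) * ENNReal.ofReal (D.ctop * (Cδ * ε₁) ^ 2)) ≤ ENNReal.ofReal 4⁻¹)
    (hsmall : ∀ {v : M → W'}, ContMDiff I 𝓘(ℝ, W') ∞ v → ∀ {ε : ℝ}, 0 ≤ ε → ε ≤ ε₀ →
      (∀ q, sobolevEnergy (m₀ + 2 * (Module.finrank ℝ E' + 1)) (PatchSystemLoc.cutExpr D.PS q v) ≤ ENNReal.ofReal (ε ^ 2)) →
      (∀ x, (x, D.u₀ x + v x) ∈ D.𝒪) ∧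
      (∀ p y, D.PS.cut p y ≠ 0 → jetQ (jetOf (v ∘ (D.PS.chart p).inv) y) ≤ D.ρ' ^ 2) ∧
      (∀ p, ∀ m ≤ m₀, ∀ y, ‖iteratedFDeriv ℝ m (PatchSystemLoc.zExpr D.PS p v) y‖ ≤ Cs * ε) ∧
      (∀ p i i' y, |D.Gc p i i' (y, jetOf (PatchSystemLoc.zExpr D.PS p v) y)| ≤ Cδ * ε))
    {v : ℕ → ℝ → M → W'}
    (hvs : ∀ k q, ContDiffOn ℝ ∞ (uncurry fun s y ↦ v k s ((D.PS.chart q).inv y)) (Icc 0 T ×ˢ (D.PS.chart q).target))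
    (hv0 : ∀ k x, v k 0 x = 0) (hv00 : ∀ s x, v 0 s x = 0)
    (heq : ∀ k, ∀ s ∈ Icc 0 T, ∀ x, derivWithin (fun s ↦ v (k + 1) s x) (Icc 0 T) s = linOp D.P D.u₀ (v (k + 1) s) x + D.theta (v k s) x)
    (hE0 : ∀ k, ∀ s ∈ Icc 0 T, ∀ q, sobolevEnergy (m₀ + 2 * (Module.finrank ℝ E' + 1)) (PatchSystemLoc.cutExpr D.PS q (v k s)) ≤ ENNReal.ofReal (ε₁ ^ 2))
    (K : ℕ) (hK : m₀ + 2 * (Module.finrank ℝ E' + 1) ≤ K) :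
    ∃ Cd : ℝ≥0∞, Cd ≠ ⊤ ∧ ∀ k, ∀ t ∈ Icc 0 T, ∀ q,
      sobolevEnergy K (PatchSystemLoc.cutExpr D.PS q (fun x ↦ v (k + 1) t x - v k t x)) ≤ Cd * (2⁻¹ : ℝ≥0∞) ^ k := by
  classical
  set n' : ℕ := 2 * (Module.finrank ℝ E' + 1) with hn'
  have hslices : ∀ k, ∀ s ∈ Icc 0 T, ContMDiff I 𝓘(ℝ, W') ∞ (v k s) ∧ (∀ x, (x, D.u₀ x + v k s x) ∈ D.𝒪) ∧
      (∀ p y, D.PS.cut p y ≠ 0 → jetQ (jetOf (v k s ∘ (D.PS.chart p).inv) y) ≤ D.ρ' ^ 2) ∧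
      (∀ p i i' y, |D.Gc p i i' (y, jetOf (PatchSystemLoc.zExpr D.PS p (v k s)) y)| ≤ Cδ * ε₁) := by
    intro k s hs
    have hvsm : ContMDiff I 𝓘(ℝ, W') ∞ (v k s) := PatchSystemLoc.contMDiff_of_chartSmooth D.PS (PatchSystemLoc.chartSmooth_slice D.PS (hvs k) hs)
    obtain ⟨hg, hj, -, hδ⟩ := hsmall hvsm hε₁.le hε₁ε₀ (hE0 k s hs)
    exact ⟨hvsm, hg, hj, hδ⟩
  have hc0 : 0 ≤ Clin.toReal := ENNReal.toReal_nonneg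
  have hClinc : Clin = ENNReal.ofReal Clin.toReal := (ENNReal.ofReal_toReal hClin).symm
  have hδ₁0 : 0 ≤ Cδ * ε₁ := mul_nonneg hCδ0 hε₁.le
  -- sup bounds of all derivatives up to `K + 2` from the energies of order `K + 2 + n'`
  obtain ⟨RE, hRE0, hRE⟩ := D.iterates_bounded hClin hAp hm₀ hT0 hT1 hε₁ hε₁ε₀ hCδ0 hδ1 htop hsmall hvs hv0 hv00 heq hE0 (K + 2 + n') (by omega)
  obtain ⟨REK, hREK0, hREK⟩ := D.iterates_bounded hClin hAp hm₀ hT0 hT1 hε₁ hε₁ε₀ hCδ0 hδ1 htop hsmall hvs hv0 hv00 heq hE0 K hK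
  obtain ⟨Cs', hCs'0, hCs'⟩ := PatchSystemLoc.norm_iteratedFDeriv_zExpr_le D.PS (F' := W') (K + 2)
  set Rall : ℝ := Cs' * Real.sqrt RE with hRall
  have hsup : ∀ k, ∀ s ∈ Icc 0 T, ∀ p, ∀ m ≤ K + 2, ∀ y, ‖iteratedFDeriv ℝ m (PatchSystemLoc.zExpr D.PS p (v k s)) y‖ ≤ Rall := by
    intro k s hs p m hm y
    refine hCs' p (PatchSystemLoc.chartSmooth_slice D.PS (hvs k) hs) (Real.sqrt_nonneg RE) (fun q ↦ ?_) m hm y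
    rw [Real.sq_sqrt hRE0]
    exact hRE k s hs q
  -- constants of the order `K`
  obtain ⟨Bd, hBdtop, hBd⟩ := D.sum_lintegral_energy_theta_sub_le K Rall
  obtain ⟨Λ, hΛ1, hap⟩ := hAp K
  have hb0 : 0 ≤ Bd.toReal := ENNReal.toReal_nonneg
  have hBb : Bd = ENNReal.ofReal Bd.toReal := (ENNReal.ofReal_toReal hBdtop).symm
  set lam : ℝ := max Λ (4 * Clin.toReal * Bd.toReal + 1) with hlam
  have hΛlam : Λ ≤ lam := le_max_left _ _
  have hlam1 : 1 ≤ lam := hΛ1.trans hΛlam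
  have hlam0 : 0 < lam := one_pos.trans_le hlam1
  have hlamcb : 4 * Clin.toReal * Bd.toReal + 1 ≤ lam := le_max_right _ _
  have hlow : Clin * (Bd * ENNReal.ofReal lam⁻¹) ≤ ENNReal.ofReal 4⁻¹ := by
    rw [hClinc, hBb, ← ENNReal.ofReal_mul hb0, ← ENNReal.ofReal_mul hc0]
    refine ENNReal.ofReal_le_ofReal ?_
    rw [← mul_assoc, ← div_eq_mul_inv, div_le_iff₀ hlam0]; nlinarith
  -- the differences
  set d : ℕ → ℝ → M → W' := fun k s x ↦ v (k + 1) s x - v k s x with hd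
  have hds : ∀ k q, ContDiffOn ℝ ∞ (uncurry fun s y ↦ d k s ((D.PS.chart q).inv y)) (Icc 0 T ×ˢ (D.PS.chart q).target) := fun k q ↦ (hvs (k + 1) q).sub (hvs k q)
  have hd0 : ∀ k x, d k 0 x = 0 := fun k x ↦ by simp [hd, hv0]
  -- the equation of the differences (k ≥ 1): source `Θ(v_k) - Θ(v_{k-1})`
  have hdeq : ∀ k, ∀ s ∈ Icc 0 T, ∀ x, derivWithin (fun s ↦ d (k + 1) s x) (Icc 0 T) s =
      linOp D.P D.u₀ (d (k + 1) s) x + (fun s x ↦ D.theta (v (k + 1) s) x - D.theta (v k s) x) s x := by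
    intro k s hs x
    have h1 := heq (k + 1) s hs x
    have h2 := heq k s hs x
    have hdw1 := PatchSystemLoc.differentiableWithinAt_time D.PS (hvs (k + 2)) hs x
    have hdw2 := PatchSystemLoc.differentiableWithinAt_time D.PS (hvs (k + 1)) hs x
    have hL := hLsub (v (k + 2) s) (v (k + 1) s) (PatchSystemLoc.chartSmooth_slice D.PS (hvs (k + 2)) hs) (PatchSystemLoc.chartSmooth_slice D.PS (hvs (k + 1)) hs) x
    simp only [hd]
    rw [derivWithin_fun_sub hdw1 hdw2, h1, h2, hL]
    abel
  -- chart-slab smoothness of the sources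
  have hΘd : ∀ k q, ContDiffOn ℝ ∞ (uncurry fun s y ↦ (fun s x ↦ D.theta (v (k + 1) s) x - D.theta (v k s) x) s ((D.PS.chart q).inv y)) (Icc 0 T ×ˢ (D.PS.chart q).target) := by
    intro k q
    have h1 := D.theta_chartSlabSmooth' hT0 (hvs (k + 1)) (fun s hs ↦ (hslices (k + 1) s hs).1) (fun s hs ↦ (hslices (k + 1) s hs).2.1) q
    have h2 := D.theta_chartSlabSmooth' hT0 (hvs k) (fun s hs ↦ (hslices k s hs).1) (fun s hs ↦ (hslices k s hs).2.1) q
    exact h1.sub h2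
  -- the weighted quantities
  set G : ℕ → ℝ≥0∞ := fun k ↦ ∑ q, PatchSystemLoc.maxRegQ K lam (fun s ↦ PatchSystemLoc.cutExpr D.PS q (d k s)) T with hG
  set cδ : ℝ≥0∞ := (Fintype.card ι : ℝ≥0∞) * ENNReal.ofReal (D.ctop * (Cδ * ε₁) ^ 2) with hcδ
  have hY : ∀ k, ∀ t ∈ Icc 0 T, ∑ p, (∫⁻ s in Ioo 0 t, ENNReal.ofReal (Real.exp (-2 * lam * s)) *
      sobolevEnergy K (PatchSystemLoc.cutExpr D.PS p (fun x ↦ D.theta (v (k + 1) s) x - D.theta (v k s) x))) ≤ cδ * G k + Bd * (ENNReal.ofReal lam⁻¹ * G k) := by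
    intro k t ht
    have h := hBd hT0 (hvs (k + 1)) (hvs k) (fun s hs ↦ (hslices (k + 1) s hs).1) (fun s hs ↦ (hslices k s hs).1)
      (fun s hs ↦ (hslices (k + 1) s hs).2.1) (fun s hs ↦ (hslices k s hs).2.1) (fun s hs ↦ (hslices (k + 1) s hs).2.2.1) (fun s hs ↦ (hslices k s hs).2.2.1)
      (hsup (k + 1)) (hsup k) hδ₁0 hδ1 (fun s hs ↦ (hslices (k + 1) s hs).2.2.2) hlam1 t ht
    refine h.trans ?_
    have hQt : ∑ q, PatchSystemLoc.maxRegQ K lam (fun s ↦ PatchSystemLoc.cutExpr D.PS q (fun x ↦ v (k + 1) s x - v k s x)) t ≤ G k :=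
      Finset.sum_le_sum fun q _ ↦ PatchSystemLoc.maxRegQ_mono_time K lam _ ht.2
    exact add_le_add (mul_le_mul' le_rfl hQt) (mul_le_mul' le_rfl (mul_le_mul' le_rfl hQt))
  have hrec : ∀ k, G (k + 1) ≤ ENNReal.ofReal 4⁻¹ * G k + ENNReal.ofReal 4⁻¹ * G k := by
    intro k
    have hen := (hap hΛlam hT0 hT1 (hds (k + 1)) (hd0 (k + 1)) (hΘd k) (hdeq k) T ⟨hT0.le, le_rfl⟩).1
    calc G (k + 1) ≤ Clin * (cδ * G k + Bd * (ENNReal.ofReal lam⁻¹ * G k)) := hen.trans (mul_le_mul' le_rfl (hY k T ⟨hT0.le, le_rfl⟩))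
      _ = Clin * cδ * G k + Clin * (Bd * ENNReal.ofReal lam⁻¹) * G k := by ring
      _ ≤ ENNReal.ofReal 4⁻¹ * G k + ENNReal.ofReal 4⁻¹ * G k := add_le_add (mul_le_mul' htop le_rfl) (mul_le_mul' hlow le_rfl)
  have hhalf : ENNReal.ofReal 4⁻¹ + ENNReal.ofReal 4⁻¹ = (2⁻¹ : ℝ≥0∞) := by
    rw [← ENNReal.ofReal_add (by norm_num) (by norm_num), show (4⁻¹ : ℝ) + 4⁻¹ = 2⁻¹ by norm_num, ENNReal.ofReal_inv_of_pos two_pos, ENNReal.ofReal_ofNat]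
  -- `G 0` is finite
  have hG0top : G 0 ≠ ⊤ := by
    have hΘ0 : ∀ q, ContDiffOn ℝ ∞ (uncurry fun s y ↦ (fun s x ↦ D.theta (v 0 s) x) s ((D.PS.chart q).inv y)) (Icc 0 T ×ˢ (D.PS.chart q).target) :=
      D.theta_chartSlabSmooth' hT0 (hvs 0) (fun s hs ↦ (hslices 0 s hs).1) (fun s hs ↦ (hslices 0 s hs).2.1)
    have hd0v : d 0 = v 1 := by funext s x; simp [hd, hv00]
    have hen := (hap hΛlam hT0 hT1 (hvs 1) (hv0 1) hΘ0 (heq 0) T ⟨hT0.le, le_rfl⟩).1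
    have hG0 : G 0 = ∑ q, PatchSystemLoc.maxRegQ K lam (fun s ↦ PatchSystemLoc.cutExpr D.PS q (v 1 s)) T := by simp only [hG, hd0v]
    rw [hG0]
    refine ne_top_of_le_ne_top ?_ hen
    refine ENNReal.mul_ne_top hClin (ENNReal.sum_ne_top.2 fun p _ ↦ ?_)
    -- the source `Θ(0)` is constant in time with finite energy
    have hθ0 : ∀ s, v 0 s = fun _ ↦ 0 := fun s ↦ funext fun x ↦ hv00 s x
    have hsm : ContDiffOn ℝ ∞ ((D.theta fun _ ↦ 0) ∘ (D.PS.chart p).inv) (D.PS.chart p).target := by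
      have h := PatchSystemLoc.chartSmooth_slice D.PS hΘ0 (s := 0) ⟨le_rfl, hT0.le⟩ p
      simpa [hθ0] using h
    have hfin : sobolevEnergy K (PatchSystemLoc.cutExpr D.PS p (D.theta fun _ ↦ 0)) ≠ ⊤ :=
      sobolevEnergy_ne_top_of_hasCompactSupport (PatchSystemLoc.contDiff_cutExpr D.PS hsm) (PatchSystemLoc.hasCompactSupport_cutExpr D.PS _) K
    refine ne_top_of_le_ne_top (ENNReal.mul_ne_top hfin (by simp [Real.volume_Ioo] : volume (Ioo (0 : ℝ) T) ≠ ⊤)) ?_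
    calc (∫⁻ s in Ioo 0 T, ENNReal.ofReal (Real.exp (-2 * lam * s)) * sobolevEnergy K (PatchSystemLoc.cutExpr D.PS p (D.theta (v 0 s))))
        ≤ ∫⁻ _s in Ioo 0 T, sobolevEnergy K (PatchSystemLoc.cutExpr D.PS p (D.theta fun _ ↦ 0)) := by
          refine setLIntegral_mono' measurableSet_Ioo fun s hs ↦ ?_
          rw [hθ0 s]
          refine mul_le_of_le_one_left' ?_
          rw [← ENNReal.ofReal_one]
          exact ENNReal.ofReal_le_ofReal (by rw [Real.exp_le_one_iff]; nlinarith [hs.1, hlam0])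
      _ = sobolevEnergy K (PatchSystemLoc.cutExpr D.PS p (D.theta fun _ ↦ 0)) * volume (Ioo (0 : ℝ) T) := setLIntegral_const _ _
  -- geometric decay of `G`
  have hGk : ∀ k, G k ≤ G 0 * (2⁻¹ : ℝ≥0∞) ^ k := by
    intro k
    induction k with
    | zero => simp
    | succ k ih =>
      calc G (k + 1) ≤ ENNReal.ofReal 4⁻¹ * G k + ENNReal.ofReal 4⁻¹ * G k := hrec k
        _ = (2⁻¹ : ℝ≥0∞) * G k := by rw [← add_mul, hhalf]
        _ ≤ (2⁻¹ : ℝ≥0∞) * (G 0 * (2⁻¹ : ℝ≥0∞) ^ k) := mul_le_mul' le_rfl ih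
        _ = G 0 * (2⁻¹ : ℝ≥0∞) ^ (k + 1) := by ring
  -- the unweighted energies of the differences
  set Cpt : ℝ≥0∞ := ENNReal.ofReal (Real.exp (2 * lam * T)) * (Clin * ENNReal.ofReal lam⁻¹ * ((cδ + Bd * ENNReal.ofReal lam⁻¹) * G 0)) * 2 with hCpt
  have hCpttop : Cpt ≠ ⊤ := ENNReal.mul_ne_top (ENNReal.mul_ne_top ENNReal.ofReal_ne_top (ENNReal.mul_ne_top (ENNReal.mul_ne_top hClin ENNReal.ofReal_ne_top)
    (ENNReal.mul_ne_top (ENNReal.add_ne_top.2 ⟨ENNReal.mul_ne_top (ENNReal.natCast_ne_top _) ENNReal.ofReal_ne_top, ENNReal.mul_ne_top hBdtop ENNReal.ofReal_ne_top⟩) hG0top))) (by norm_num)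
  refine ⟨Cpt + ENNReal.ofReal REK * 4, ENNReal.add_ne_top.2 ⟨hCpttop, ENNReal.mul_ne_top ENNReal.ofReal_ne_top (by norm_num)⟩, fun k t ht q ↦ ?_⟩
  rcases k with _ | k
  · -- `k = 0`: the difference is `v 1`
    have h1 : (fun x ↦ v (0 + 1) t x - v 0 t x) = v 1 t := by funext x; simp [hv00]
    rw [h1, pow_zero, mul_one]
    calc sobolevEnergy K (PatchSystemLoc.cutExpr D.PS q (v 1 t)) ≤ ENNReal.ofReal REK := hREK 1 t ht q
      _ ≤ ENNReal.ofReal REK * 4 := le_mul_of_one_le_right' (by norm_num)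
      _ ≤ Cpt + ENNReal.ofReal REK * 4 := le_add_self
  · have hpt := ((hap hΛlam hT0 hT1 (hds (k + 1)) (hd0 (k + 1)) (hΘd k) (hdeq k) t ht).2 q).trans (mul_le_mul' le_rfl (hY k t ht))
    have hexp : ENNReal.ofReal (Real.exp (2 * lam * t)) * ENNReal.ofReal (Real.exp (-2 * lam * t)) = 1 := by
      rw [← ENNReal.ofReal_mul (Real.exp_pos _).le, ← Real.exp_add]; norm_num
    have hes : ENNReal.ofReal (Real.exp (2 * lam * t)) ≤ ENNReal.ofReal (Real.exp (2 * lam * T)) :=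
      ENNReal.ofReal_le_ofReal (Real.exp_le_exp.2 (by nlinarith [ht.2, hlam0.le]))
    have hfun : (fun x ↦ v (k + 1 + 1) t x - v (k + 1) t x) = d (k + 1) t := rfl
    rw [hfun]
    calc sobolevEnergy K (PatchSystemLoc.cutExpr D.PS q (d (k + 1) t))
        = ENNReal.ofReal (Real.exp (2 * lam * t)) * (ENNReal.ofReal (Real.exp (-2 * lam * t)) * sobolevEnergy K (PatchSystemLoc.cutExpr D.PS q (d (k + 1) t))) := by
          rw [← mul_assoc, hexp, one_mul]
      _ ≤ ENNReal.ofReal (Real.exp (2 * lam * T)) * (Clin * ENNReal.ofReal lam⁻¹ * (cδ * G k + Bd * (ENNReal.ofReal lam⁻¹ * G k))) := mul_le_mul' hes hpt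
      _ = ENNReal.ofReal (Real.exp (2 * lam * T)) * (Clin * ENNReal.ofReal lam⁻¹ * ((cδ + Bd * ENNReal.ofReal lam⁻¹) * G k)) := by ring
      _ ≤ ENNReal.ofReal (Real.exp (2 * lam * T)) * (Clin * ENNReal.ofReal lam⁻¹ * ((cδ + Bd * ENNReal.ofReal lam⁻¹) * (G 0 * (2⁻¹ : ℝ≥0∞) ^ k))) := by
          gcongr; exact hGk k
      _ = Cpt * (2⁻¹ : ℝ≥0∞) ^ (k + 1) := by
          rw [hCpt, pow_succ]
          have h2 : (2 : ℝ≥0∞) * 2⁻¹ = 1 := ENNReal.mul_inv_cancel (by norm_num) (by norm_num)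
          calc _ = ENNReal.ofReal (Real.exp (2 * lam * T)) * (Clin * ENNReal.ofReal lam⁻¹ * ((cδ + Bd * ENNReal.ofReal lam⁻¹) * G 0)) * (2⁻¹ : ℝ≥0∞) ^ k * 1 := by ring
            _ = _ := by rw [← h2]; ring
      _ ≤ (Cpt + ENNReal.ofReal REK * 4) * (2⁻¹ : ℝ≥0∞) ^ (k + 1) := mul_le_mul' le_self_add le_rfl

end Iterates

end Literature.Analysis.PDE
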